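import Summits.CriticalPhenomena.Ising3DConformalLimit.Theses.SubPtolemyInterlacing
import Literature.Probability.LatticeModels.SourcedDoubleCurrentsSwitching

/-!
# SketchIdeatorK2 — crux-ideate stmt-CriticalPhenomena-15702 (`Interlacing`), ideator k = 2, round 1

First lemmas of the two idea cards `interlaced-meeting-threshold` and `seam-spectral-level-spacing`,
typed over existing declarations (statements only; proofs are the line's business). Every `def` below is a
`Prop`; the `theorem`s are the claimed first lemmas (`sorry`).
-/

noncomputable section

namespace Summit.CriticalPhenomena.Ising3DConformalLimit.Cruxes.Interlacing.IdeatorK2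

open Literature.Probability.LatticeModels Literature.Probability.Percolation MeasureTheory
open scoped symmDiff

/-- The axis point `k·e₁ ∈ ℤ³` (same spelling as the route decl `Interlacing`). -/
def ax (k : ℕ) : Site 3 := (k : ℤ) • (Pi.single 0 1 : Site 3)

/-- Critical two-point function `G(x,y) = ⟨σ_xσ_y⟩⁺_{β_c(3)}`. -/
abbrev G (x y : Site 3) : ℝ := criticalCorr 3 2 ![x, y]

/-- Critical four-point function. -/
abbrev S4 (x y z t : Site 3) : ℝ := criticalCorr 3 4 ![x, y, z, t]

/-- The infinite-volume sourced double current `P^{A,B}_{β_c}` on `ℤ³` (trace law). -/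
abbrev Pc (A B : Finset (Site 3)) : Measure (BondConfig (Site 3)) :=
  sourcedDoubleCurrentLawInf 3 (criticalBeta 3) A B

/-! ## Card `interlaced-meeting-threshold` -/

/-- The interlaced MEETING PROBABILITY `I×(a,b,c) := P^{x₁x₃, x₂x₄}_{β_c}[x₁ ↔ x₂ in n̂₁ ∪ n̂₂]` of the two
independent sourced currents with INTERLACED collinear source pairs `{x₁,x₃} = {0,(a+b)e₁}`,
`{x₂,x₄} = {a e₁,(a+b+c)e₁}` (the event of ADC21 (3.11): the two source clusters merge). -/
def meet (a b c : ℕ) : ℝ :=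
  (Pc ({ax 0} ∆ {ax (a + b)}) ({ax a} ∆ {ax (a + b + c)})).real (openConn (ax 0) (ax a))

/-- The SPC DEFICIT functional of the six two-point values: with `P₁ = G₁₂G₃₄`, `P₂ = G₁₃G₂₄` (crossing),
`P₃ = G₁₄G₂₃`, `W := P₁ + P₂ + P₃ - P₁P₃/P₂ = P₂·(2 - (u-1)(t-1))`, `u = P₁/P₂`, `t = P₃/P₂`.
SPC ⟺ `-U₄ ≥ W` ⟺ `2 P₂ · I× ≥ W` ⟺ `I× ≥ ι* := W/(2P₂) = 1 - (u-1)(t-1)/2`. -/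
def deficit (a b c : ℕ) : ℝ :=
  let P₁ := G (ax 0) (ax a) * G (ax (a + b)) (ax (a + b + c))
  let P₂ := G (ax 0) (ax (a + b)) * G (ax a) (ax (a + b + c))
  let P₃ := G (ax 0) (ax (a + b + c)) * G (ax a) (ax (a + b))
  P₁ + P₂ + P₃ - P₁ * P₃ / P₂

/-- The threshold form of the crux: `ι*(a,b,c) ≤ I×(a,b,c)` for all gaps, written without division by `P₂`. -/
def MeetingThreshold : Prop :=
  ∀ a b c : ℕ, 1 ≤ a → 1 ≤ b → 1 ≤ c →
    deficit a b c ≤ 2 * (G (ax 0) (ax (a + b)) * G (ax a) (ax (a + b + c))) * meet a b c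

/-- FIRST LEMMA (card `interlaced-meeting-threshold`): given ADC21 (3.11) in infinite volume at `β_c`
(named fact `freeUrsellFour_eq_sourcedDoubleCurrent 3`, unproved in tree) and strict positivity of the
critical two-point function on the axis (Griffiths; `criticalTwoPoint_bounds`-type input), the crux
`Interlacing` is EQUIVALENT to the meeting-threshold inequality. Pure algebra after rewriting
`U₄(x₁,x₃,x₂,x₄) = -2 G₁₃ G₂₄ · I×` and the permutation invariance of `criticalCorr 3 4`. -/
theorem interlacing_iff_meetingThreshold (hU : freeUrsellFour_eq_sourcedDoubleCurrent 3)
    (hpos : ∀ m n : ℕ, m ≠ n → 0 < G (ax m) (ax n)) :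
    Theses.SubPtolemyInterlacing.Interlacing ↔ MeetingThreshold := by
  sorry

/-- The pure-number fact behind the card's threshold table: for an exact power law `G = d^{-s}` with `s = 1`
(η = 0) one has `(u-1)(t-1) = 1` identically in the shape, so `ι* ≡ 1/2`:
`[(a+b)(b+c)/(ac) - 1]·[(a+b)(b+c)/(b(a+b+c)) - 1] = 1`. -/
theorem shape_identity (a b c : ℝ) (ha : 0 < a) (hb : 0 < b) (hc : 0 < c) :
    ((a + b) * (b + c) / (a * c) - 1) * ((a + b) * (b + c) / (b * (a + b + c)) - 1) = 1 := by
  have hac : a * c ≠ 0 := by positivity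
  have hb' : b * (a + b + c) ≠ 0 := by positivity
  field_simp
  ring

/-- ENGINE STUB of the card (the honest residual, "sourced fatness"): a scale-free LOWER bound on the one-point
function of the cluster of a source under the SINGLE sourced current, by a constant multiple of the
double-current formula `⟨σ_xσ_v⟩⟨σ_vσ_y⟩/⟨σ_xσ_y⟩` (the chain rule / ADC21 (3.10) give only the upper bound).
Written on the trace law with an EMPTY second source set is NOT the single current (that is the dressed
cluster, for which equality holds); the single-current law is not a tree object yet, so the stub is recorded
here only through its dressed upper face, which IS typable: -/
def DressedOnePoint : Prop :=
  ∀ x y v : Site 3, x ≠ y →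
    (Pc ({x} ∆ {y}) ∅).real (openConn x v) * G x y = G x v * G v y

/-- The dressed one-point identity is exactly ADC21 (3.10) with `B = {x,v}… ` — provable now from the named
fact `freeCorr_mul_eq_sourcedDoubleCurrent_subcurrent 3` (its corollary
`.plusCorr_criticalBeta_pair` with `A = {x,y}`, `a = x`, `b = v`). -/
theorem dressedOnePoint_of_fact (h : freeCorr_mul_eq_sourcedDoubleCurrent_subcurrent 3) :
    DressedOnePoint := by
  sorry

/-! ## Card `seam-spectral-level-spacing` -/

/-- Reflection positivity through the bond/site planes perpendicular to `e₁`, passed to the infinite-volume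
critical state, makes `b ↦ S₄(c,b,c)` (two equal outer gaps) a POSITIVE-DEFINITE sequence in the Hankel
sense — the `b`-channel Källén–Lehmann structure the card's spectral criterion lives on. First lemma (i). -/
def DiagonalHankelPSD : Prop :=
  ∀ (c n : ℕ) (k : Fin n → ℕ) (ξ : Fin n → ℝ), 1 ≤ c →
    0 ≤ ∑ i, ∑ j, ξ i * ξ j * S4 (ax 0) (ax c) (ax (c + (k i + k j))) (ax (c + (k i + k j) + c))

/-- First lemma (ii): the same for the two-point function (`b ↦ G(b)` is a Hausdorff moment sequence), whose
`2 × 2` case is the axial LOG-CONVEXITY `G(a+b) G(b+c) ≤ G(b) G(a+b+c)`, i.e. `P₂ ≤ P₃` (`t ≥ 1`) — the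
two-point shadow of SPC and the reason the threshold `ι*` never exceeds `1/2 + O(η)`. -/
def AxialLogConvex : Prop :=
  ∀ a b c : ℕ, G (ax 0) (ax (a + b)) * G (ax a) (ax (a + b + c)) ≤ G (ax a) (ax (a + b)) * G (ax 0) (ax (a + b + c))

theorem axialLogConvex_holds : AxialLogConvex := by
  sorry

/-- First lemma (iii), the LEBOWITZ–ORNSTEIN–ZERNIKE corner (the part of the card provable with today's tools,
stated at `β_c` in the only form that survives there): SPC holds whenever the crossing and nested pairings are
dominated quantitatively, `(u - 1)(t - 1) ≥ 2`, by Lebowitz `U₄ ≤ 0` alone. -/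
theorem interlacing_of_lebowitz_regime (hU : freeUrsellFour_eq_sourcedDoubleCurrent 3) (a b c : ℕ)
    (ha : 1 ≤ a) (hb : 1 ≤ b) (hc : 1 ≤ c)
    (hpos : ∀ m n : ℕ, m ≠ n → 0 < G (ax m) (ax n))
    (hreg : 2 * (G (ax 0) (ax (a + b)) * G (ax a) (ax (a + b + c))) ^ 2 ≤
      (G (ax 0) (ax a) * G (ax (a + b)) (ax (a + b + c)) - G (ax 0) (ax (a + b)) * G (ax a) (ax (a + b + c))) *
        (G (ax 0) (ax (a + b + c)) * G (ax a) (ax (a + b)) - G (ax 0) (ax (a + b)) * G (ax a) (ax (a + b + c)))) :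
    S4 (ax 0) (ax a) (ax (a + b)) (ax (a + b + c)) *
        (G (ax 0) (ax (a + b)) * G (ax a) (ax (a + b + c))) ≤
      G (ax 0) (ax a) * G (ax (a + b)) (ax (a + b + c)) * (G (ax 0) (ax (a + b + c)) * G (ax a) (ax (a + b))) := by
  sorry

end Summit.CriticalPhenomena.Ising3DConformalLimit.Cruxes.Interlacing.IdeatorK2
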